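import Mathlib
import HarnessLib
import Summits.Ventures.LatticeQCDFlow.Exactness.SUNResidualJacobiFlow
import Summits.Ventures.LatticeQCDFlow.Exactness.SUNResidualLayerJacobian
import Literature.Analysis.ODE.PfaffianTransportFactor
import Summits.Ventures.LatticeQCDFlow.TrivializingMaps.JacobianDensity

/-!
# The exact Jacobian of the masked `SU(N)` residual / stout layer IS the closed-form product of one-link determinants, for every `N`

HONEST FRAMING: exact (Metropolis-corrected) sampling algorithms for lattice gauge theory;
figures of merit are autocorrelation/cost numbers at stated couplings and volumes; no
continuum-physics claim.

Venture `LatticeQCDFlow` (cell pub-lqcd), topic `Exactness`; FANOUT row 10 (`eng-equiv`: `equiv/residual.py`,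
`flows_jax/residual_flow.py` — residual / stout / stout-defect layers and their closed-form per-link log-det).
NEW WORK of the cell; no definition (local notations only); nothing cited as a fact.  Series "the residual
layer's exact Jacobian IS the closed form" (8 files: `SUNJacobianTraceAlgebra`, `SUNResidualTangentDerivative`,
`SUNResidualTangentTimeDerivative`, `SUNResidualGeneratorDivergence`, `SUNResidualJacobiTrace`,
`SUNResidualJacobiIdentity`, `SUNResidualJacobiFlow`, `SUNResidualLayerJacobianDet`), continuing gen-11's
`SUNResidualLayerVelocity` … `SUNResidualLayerJacobian` (existence of a continuous positive exact Jacobian).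

File 8 of the series — the MAIN THEOREM (local notations as before).
* **`prod_det_residualTangentOp_flow_one`** — Liouville along the inverse isotopy: for the generator `Z` and any
  flow map `Φ` of `Z`, `∏_{a active} det Top[σ(1), Φ_1 V, a] = exp(−∫₀¹ div Z_s(Φ_s V) ds)` (logarithmic
  derivative `−div` by `SUNResidualJacobiFlow` + `linkDiv_generator_eq`; value `1` at `s = 0`; the scalar linear
  equation by `Literature.Analysis.ODE.eq_exp_smul_of_hasDerivWithinAt`);
* **`hasJacobian_sunResidualLayer_det`** — for every `d`, `L ≥ 1`, `n`, mask `p`, exponents under the engine's guard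
  (`Q a y : SU(n) → 𝔰𝔲(n)`, `κ a y`-Lipschitz Frobenius, `0 ≤ κ a y < 1`) realised by `C²` ambient exponents:
  (o) `U ↦ ∏_{a active} det Top[1, U, a]` is continuous; (i) `0 < ∏_{a active} det Top[1, U, a]` everywhere; (ii)
  `HasJacobian (⊗_e Haar_{SU(n)}) (masked residual layer) (ofReal ∘ ∏_{a active} det Top[1, U, a])`.
  `Top[1, U, a] X = 𝒫((∂_{single a (𝒫X·U_a)}(e^{Q}u))(e^{Q}u)ᴴ) + (X − 𝒫X)` is the right-trivialised tangential
  derivative of the one-link map at the active link (identity off `𝔰𝔲(n)`), so `det Top[1, U, a]` is the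
  determinant of the `(n²−1)×(n²−1)` one-link Jacobian `((∂_{T^c}(e^{Q}u)·(e^{Q}u)ᴴ)^b)_{bc}` in any orthonormal
  basis of `𝔰𝔲(n)` — what the engine books as the layer's log-det, summed over active links.  With gen-11's
  `HasJacobian.jac_ae_eq`, the Liouville Jacobian of `hasJacobian_sunResidualLayer` equals it a.e.
  Route: `exists_flowMap_pushforward_density` (Lüscher (3.9), row 31) WITH its formula `q(Φ_1 V) = exp(−∫₀¹ div)`,
  `prod_det_residualTangentOp_flow_one`, and `layer ∘ Φ_1 = id` (`residualIsotopy_flowMap_eq`).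

Printed counterparts, NAMED ONLY: Lüscher, CMP 293 (2010) 899, §3 eqs. (3.4)–(3.9); Abbott et al.,
arXiv:2305.02402 §4.2; Morningstar–Peardon, PRD 69 (2004) 054501; Abel–Jacobi–Liouville (tree:
`Literature.Analysis.ODE.LiouvilleFormula`).
-/

noncomputable section

namespace Summit.Ventures.LatticeQCDFlow.Exactness

open Literature.MathematicalPhysics.QuantumFieldTheory
open Literature.MathematicalPhysics.QuantumFieldTheory.Luscher2010
open Literature.MathematicalPhysics.QuantumFieldTheory.WilsonFlow
open Summit.Ventures.LatticeQCDFlow.TrivializingMaps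
open MeasureTheory Filter Set
open scoped Matrix Matrix.Norms.Frobenius Topology ContDiff ENNReal

variable {d L n : ℕ} [NeZero L]

section Main

variable (p : Edge d L → Prop) [DecidablePred p]
  (Q : {e : Edge d L // p e} → ({f : Edge d L // ¬p f} → Matrix.specialUnitaryGroup (Fin n) ℂ) →
    Matrix (Fin n) (Fin n) ℂ → Matrix (Fin n) (Fin n) ℂ)
  (κ : {e : Edge d L // p e} → ({f : Edge d L // ¬p f} → Matrix.specialUnitaryGroup (Fin n) ℂ) → ℝ)
  (Qamb : {e : Edge d L // p e} → AmbConfig d L n → Matrix (Fin n) (Fin n) ℂ)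

set_option quotPrecheck false in
/-- The residual isotopy at time `τ` (local notation, as in `SUNResidualIsotopy`). -/
local notation "famb[" τ "]" => (fun (W : AmbConfig d L n) (e : Edge d L) =>
  if h : p e then NormedSpace.exp ((τ : ℝ) • Qamb ⟨e, h⟩ W) * W e else W e)

set_option quotPrecheck false in
/-- The block of the tangential operator (local notation, as in `SUNResidualTangentOperator`). -/
local notation "Blk[" τ ", " W ", " a "]" =>
  ((fderiv ℝ (fun Y : Matrix (Fin n) (Fin n) ℂ => Y * ((famb[τ]) W a)ᴴ) 0).comp
    ((fderiv ℝ (fun W' : AmbConfig d L n => W' a) 0).comp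
      ((fderiv ℝ (famb[τ]) W).comp
        ((fderiv ℝ (fun Y : Matrix (Fin n) (Fin n) ℂ => (Pi.single a Y : AmbConfig d L n)) 0).comp
          (fderiv ℝ (fun Y : Matrix (Fin n) (Fin n) ℂ => Y * W a) 0)))))

set_option quotPrecheck false in
/-- The tangential operator (local notation, as in `SUNResidualTangentOperator`). -/
local notation "Top[" τ ", " W ", " a "]" =>
  ((fderiv ℝ (suProj (n := n)) 0).comp ((Blk[τ, W, a]).comp (fderiv ℝ (suProj (n := n)) 0)) +
    (ContinuousLinearMap.id ℝ (Matrix (Fin n) (Fin n) ℂ) - fderiv ℝ (suProj (n := n)) 0))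

set_option quotPrecheck false in
/-- The time reparametrisation `σ(s) = (1 − cos πs)/2` (local notation). -/
local notation "σ(" s ")" => ((1 - Real.cos (Real.pi * s)) / 2)

set_option quotPrecheck false in
/-- Its derivative `σ′(s) = (π/2) sin πs` (local notation). -/
local notation "σ'(" s ")" => (Real.pi / 2 * Real.sin (Real.pi * s))

/-! ## The product of the one-link determinants solves the scalar Liouville equation -/

/-- **Liouville along the inverse isotopy.**  For the generator `Z` of the inverse residual isotopy and any
flow map `Φ` of `Z`:
`∏_{a active} det Top[σ(1), Φ_1 V, a] = exp(−∫₀¹ div Z_s(Φ_s V) ds)`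
(the product has logarithmic derivative `−div Z_s(Φ_s V)` by Jacobi's formula link by link, and equals `1`
at `s = 0`). -/
theorem prod_det_residualTangentOp_flow_one (B : SuBasis n) (hQ2 : ∀ a, ContDiff ℝ 2 (Qamb a))
    (hQ : ∀ a y, ∀ U ∈ Matrix.specialUnitaryGroup (Fin n) ℂ, (Q a y U)ᴴ = -Q a y U ∧ (Q a y U).trace = 0)
    (hlip : ∀ a y, ∀ U ∈ Matrix.specialUnitaryGroup (Fin n) ℂ, ∀ V ∈ Matrix.specialUnitaryGroup (Fin n) ℂ,
      frobNorm (Q a y U - Q a y V) ≤ κ a y * frobNorm (U - V))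
    (hκ0 : ∀ a y, 0 ≤ κ a y) (hκ : ∀ a y, κ a y < 1)
    (hQambQ : ∀ a (U : GaugeConfig d L (Matrix.specialUnitaryGroup (Fin n) ℂ)),
      Qamb a (coeConfig U) = Q a (fun f => U f) (U a.1 : Matrix (Fin n) (Fin n) ℂ))
    {Z : ℝ → AmbConfig d L n → AmbConfig d L n}
    (hZ1 : ContDiff ℝ 1 (fun q : ℝ × AmbConfig d L n => Z q.1 q.2))
    (hZsu : ∀ (s : ℝ) (U : GaugeConfig d L (Matrix.specialUnitaryGroup (Fin n) ℂ)) (e : Edge d L),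
      (Z s (coeConfig U) e)ᴴ = -Z s (coeConfig U) e ∧ (Z s (coeConfig U) e).trace = 0)
    (hZ0 : ∀ (s : ℝ) (W : AmbConfig d L n) (e : Edge d L), ¬p e → Z s W e = 0)
    (hZid : ∀ (s : ℝ) (U : GaugeConfig d L (Matrix.specialUnitaryGroup (Fin n) ℂ)) (a : Edge d L) (ha : p a),
      fderiv ℝ (famb[σ(s)]) (coeConfig U) (Pi.single a (Z s (coeConfig U) a * (U a : Matrix (Fin n) (Fin n) ℂ))) a =
        -(σ'(s) • (Qamb ⟨a, ha⟩ (coeConfig U) *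
          (NormedSpace.exp (σ(s) • Qamb ⟨a, ha⟩ (coeConfig U)) * (U a : Matrix (Fin n) (Fin n) ℂ)))))
    {Φ : ℝ → GaugeConfig d L (Matrix.specialUnitaryGroup (Fin n) ℂ) →
      GaugeConfig d L (Matrix.specialUnitaryGroup (Fin n) ℂ)} (hΦ : IsFlowMap Z Φ)
    (V : GaugeConfig d L (Matrix.specialUnitaryGroup (Fin n) ℂ)) :
    ∏ a : {e : Edge d L // p e}, (Top[σ((1 : ℝ)), coeConfig (Φ 1 V), a.1]).det =
      Real.exp (-∫ s in (0 : ℝ)..1, linkDiv B (Z s) (coeConfig (Φ s V))) := by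
  -- the divergence along the flow, split over active links
  obtain ⟨ℓ, hℓ⟩ : ∃ ℓ : ℝ → ℝ, ℓ = fun u => linkDiv B (Z u) (coeConfig (Φ u V)) := ⟨_, rfl⟩
  have hdiv : ∀ u, ℓ u = ∑ a : {e : Edge d L // p e}, ∑ b,
      B.coord b (fderiv ℝ (fun W : AmbConfig d L n => Z u W a.1) (coeConfig (Φ u V))
        (Pi.single a.1 (B.T b * ((Φ u V) a.1 : Matrix (Fin n) (Fin n) ℂ)))) := by
    intro u
    rw [hℓ]
    exact linkDiv_generator_eq p B hZ1 hZ0 u (coeConfig (Φ u V))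
  -- the product of determinants and its logarithmic derivative
  have hDd : ∀ u, HasDerivAt (fun u' : ℝ => ∏ a : {e : Edge d L // p e}, (Top[σ(u'), coeConfig (Φ u' V), a.1]).det)
      (-ℓ u * ∏ a : {e : Edge d L // p e}, (Top[σ(u), coeConfig (Φ u V), a.1]).det) u := by
    intro u
    have hf : ∀ a ∈ (Finset.univ : Finset {e : Edge d L // p e}),
        HasDerivAt (fun u' : ℝ => (Top[σ(u'), coeConfig (Φ u' V), a.1]).det)
          ((Top[σ(u), coeConfig (Φ u V), a.1]).det *
            -(∑ b, B.coord b (fderiv ℝ (fun W : AmbConfig d L n => Z u W a.1) (coeConfig (Φ u V))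
              (Pi.single a.1 (B.T b * ((Φ u V) a.1 : Matrix (Fin n) (Fin n) ℂ)))))) u :=
      fun a _ => hasDerivAt_det_residualTangentOp_flow p Q κ Qamb B hQ2 hQ hlip hκ0 hκ hQambQ hZ1 hZsu hZ0 hZid
        hΦ V a.2 u
    have h := HasDerivAt.fun_finsetProd hf
    refine h.congr_deriv ?_
    have hterm : ∀ i ∈ (Finset.univ : Finset {e : Edge d L // p e}),
        (∏ j ∈ Finset.univ.erase i, (Top[σ(u), coeConfig (Φ u V), j.1]).det) •
          ((Top[σ(u), coeConfig (Φ u V), i.1]).det *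
            -(∑ b, B.coord b (fderiv ℝ (fun W : AmbConfig d L n => Z u W i.1) (coeConfig (Φ u V))
              (Pi.single i.1 (B.T b * ((Φ u V) i.1 : Matrix (Fin n) (Fin n) ℂ)))))) =
        (∏ j : {e : Edge d L // p e}, (Top[σ(u), coeConfig (Φ u V), j.1]).det) *
          -(∑ b, B.coord b (fderiv ℝ (fun W : AmbConfig d L n => Z u W i.1) (coeConfig (Φ u V))
              (Pi.single i.1 (B.T b * ((Φ u V) i.1 : Matrix (Fin n) (Fin n) ℂ))))) := by
      intro i hi
      rw [smul_eq_mul, ← mul_assoc, Finset.prod_erase_mul _ _ hi]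
    rw [Finset.sum_congr rfl hterm, ← Finset.mul_sum, Finset.sum_neg_distrib, ← hdiv u]
    ring
  -- the scalar Liouville equation on `[0, 1]`
  have hℓc : Continuous ℓ := by
    rw [hℓ]
    have hc : Continuous fun u : ℝ => coeConfig (Φ u V) := by
      refine continuous_iff_continuousAt.2 fun u => ?_
      exact (FlowExistence.hasDerivAt_of_isFlowLine (hΦ.2 V) u).continuousAt
    have h1 := (continuous_linkDiv_param B hZ1).comp ((continuous_id (X := ℝ)).prodMk hc)
    exact h1.congr (fun u => rfl)
  have hsol := Literature.Analysis.ODE.eq_exp_smul_of_hasDerivWithinAt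
    (g := fun u' : ℝ => ∏ a : {e : Edge d L // p e}, (Top[σ(u'), coeConfig (Φ u' V), a.1]).det)
    (γ := fun u => -ℓ u) (T := 1) hℓc.neg.continuousOn (fun t _ => (hDd t).hasDerivWithinAt) 1
    ⟨zero_le_one, le_rfl⟩
  -- the initial value
  have hD0 : ∏ a : {e : Edge d L // p e}, (Top[σ((0 : ℝ)), coeConfig (Φ 0 V), a.1]).det = 1 := by
    refine Finset.prod_eq_one fun a _ => ?_
    have hσ0 : ((1 - Real.cos (Real.pi * 0)) / 2 : ℝ) = 0 := by rw [mul_zero, Real.cos_zero]; norm_num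
    rw [hσ0, hΦ.1 V, residualTangentOp_zero p Qamb V a.1]
    exact LinearMap.det_id
  beta_reduce at hsol
  rw [hD0, smul_eq_mul] at hsol
  -- (`mul_one` must not be rewritten blindly: `Real.pi * 1` sits inside `σ(1)`)
  have h2 : Real.exp (∫ τ in (0 : ℝ)..1, -ℓ τ) * 1 =
      Real.exp (-∫ s in (0 : ℝ)..1, linkDiv B (Z s) (coeConfig (Φ s V))) := by
    rw [mul_one, intervalIntegral.integral_neg, hℓ]
  rw [h2] at hsol
  exact hsol

/-! ## The closed form of the Jacobian -/

/-- **The masked `SU(N)` residual / stout layer has the CLOSED-FORM Jacobian `∏_{a active} det Top[1, U, a]`.**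
Under the engine's guard (`Q a y : SU(n) → 𝔰𝔲(n)` `κ a y`-Lipschitz in the Frobenius norm with
`0 ≤ κ a y < 1`), realised by `C²` ambient exponents `Qamb`:
`HasJacobian (⊗_e Haar_{SU(n)}) layer (ofReal ∘ ∏_{a active} det Top[1, U, a])`, where `Top[1, U, a]` is the
right-trivialised tangential derivative of the one-link map `u ↦ e^{Q a y u} u` at `U_a` padded by the
identity off `𝔰𝔲(n)` — i.e. the exact Jacobian IS the product over active links of the determinants of the
`(n² − 1) × (n² − 1)` one-link Jacobian matrices `((∂_{T^c} e^{Q} u · (e^{Q} u)ᴴ)^b)_{bc}` that the engine books.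
Proof: the layer's exact Jacobian is Liouville's `exp(−∫₀¹ div Z_s ∘ Φ_s)` along the inverse isotopy
(Lüscher's formula (3.9)); by Jacobi's formula this equals the product of determinants. -/
theorem hasJacobian_sunResidualLayer_det
    (hQ : ∀ a y, ∀ U ∈ Matrix.specialUnitaryGroup (Fin n) ℂ, (Q a y U)ᴴ = -Q a y U ∧ (Q a y U).trace = 0)
    (hlip : ∀ a y, ∀ U ∈ Matrix.specialUnitaryGroup (Fin n) ℂ, ∀ V ∈ Matrix.specialUnitaryGroup (Fin n) ℂ,
      frobNorm (Q a y U - Q a y V) ≤ κ a y * frobNorm (U - V))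
    (hκ0 : ∀ a y, 0 ≤ κ a y) (hκ : ∀ a y, κ a y < 1)
    (hQ2 : ∀ a, ContDiff ℝ 2 (Qamb a))
    (hQambQ : ∀ a (U : GaugeConfig d L (Matrix.specialUnitaryGroup (Fin n) ℂ)),
      Qamb a (coeConfig U) = Q a (fun f => U f) (U a.1 : Matrix (Fin n) (Fin n) ℂ)) :
    Continuous (fun U : GaugeConfig d L (Matrix.specialUnitaryGroup (Fin n) ℂ) =>
      ∏ a : {e : Edge d L // p e}, (Top[(1 : ℝ), coeConfig U, a.1]).det) ∧
    (∀ U : GaugeConfig d L (Matrix.specialUnitaryGroup (Fin n) ℂ),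
      0 < ∏ a : {e : Edge d L // p e}, (Top[(1 : ℝ), coeConfig U, a.1]).det) ∧
    HasJacobian (Measure.pi fun _ : Edge d L => haarProbability (Matrix.specialUnitaryGroup (Fin n) ℂ))
      (Theory2.coupleFun p (fun a y (u : Matrix.specialUnitaryGroup (Fin n) ℂ) =>
        (⟨NormedSpace.exp (Q a y u) * u, residual_value_mem (hQ a y) u.2⟩ :
          Matrix.specialUnitaryGroup (Fin n) ℂ)))
      (fun U => ENNReal.ofReal (∏ a : {e : Edge d L // p e}, (Top[(1 : ℝ), coeConfig U, a.1]).det)) := by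
  haveI : SecondCountableTopology (Matrix (Fin n) (Fin n) ℂ) :=
    inferInstanceAs (SecondCountableTopology (Fin n → Fin n → ℂ))
  haveI : SecondCountableTopology (Matrix.specialUnitaryGroup (Fin n) ℂ) :=
    Topology.IsEmbedding.subtypeVal.secondCountableTopology
  -- the generator and its flow
  obtain ⟨Z, hZ1, hZsu, hZ0, hZid⟩ :=
    exists_residualIsotopy_generator p Q κ Qamb hQ2 hQ hlip hκ0 hκ hQambQ
  have hZt : Generator.IsTangent Z := fun t U e => (mem_suAlgebra_iff _).2 (hZsu t U e)
  have hΦ := FlowExistence.isFlowMap_flowMap hZ1 hZt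
  -- Lüscher's Jacobian formula: the flow at time 1 pushes product Haar to `q · Haar`, with the formula for `q`
  obtain ⟨q, hqc, hq0, hqf, hmap⟩ := exists_flowMap_pushforward_density (SuBasisExistence.stdSuBasis n)
    hZ1 hZt hΦ 1
  -- the closed form: `q = ∏ det Top[1, ·, a]`
  have hσ1 : ((1 - Real.cos (Real.pi * 1)) / 2 : ℝ) = 1 := by rw [mul_one, Real.cos_pi]; norm_num
  have hqJ : ∀ U, q U = ∏ a : {e : Edge d L // p e}, (Top[(1 : ℝ), coeConfig U, a.1]).det := by
    intro U
    obtain ⟨V, rfl⟩ := (flowMap_bijective hZ1 hZt hΦ 1).2 U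
    have h := prod_det_residualTangentOp_flow_one p Q κ Qamb (SuBasisExistence.stdSuBasis n) hQ2 hQ hlip hκ0 hκ
      hQambQ hZ1 hZsu hZ0 hZid hΦ V
    rw [hσ1] at h
    rw [hqf V, ← h]
  have hfunJ : (fun U : GaugeConfig d L (Matrix.specialUnitaryGroup (Fin n) ℂ) =>
      ∏ a : {e : Edge d L // p e}, (Top[(1 : ℝ), coeConfig U, a.1]).det) = q := funext fun U => (hqJ U).symm
  refine ⟨hfunJ ▸ hqc, fun U => (hqJ U) ▸ hq0 U, ?_⟩
  -- the layer inverts the flow at time 1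
  set F := Theory2.coupleFun p (fun a y (u : Matrix.specialUnitaryGroup (Fin n) ℂ) =>
    (⟨NormedSpace.exp (Q a y u) * u, residual_value_mem (hQ a y) u.2⟩ :
      Matrix.specialUnitaryGroup (Fin n) ℂ)) with hF
  have hFΦ : ∀ V, F (FlowExistence.flowMap hZ1 1 V) = V := by
    intro V
    apply coeConfig_injective
    rw [hF, coeConfig_sunResidualLayer p Q Qamb hQ hQambQ]
    have h := residualIsotopy_flowMap_eq p Q Qamb hQ2 hQambQ hZ1 hZt hZ0 hZid 1 V
    rwa [hσ1] at h
  have hFcont : Continuous F := by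
    have hF' : F = fun (U : GaugeConfig d L (Matrix.specialUnitaryGroup (Fin n) ℂ)) (e : Edge d L) =>
        if h : p e then (⟨NormedSpace.exp (Qamb ⟨e, h⟩ (coeConfig U)) * (U e : Matrix (Fin n) (Fin n) ℂ),
          by
            have hm := residualIsotopy_mem p Q Qamb hQ hQambQ 1 U e
            simpa only [h, ↓reduceDIte, one_smul, coeConfig_apply] using hm⟩ :
            Matrix.specialUnitaryGroup (Fin n) ℂ)
        else U e := by
      funext U e
      by_cases he : p e
      · rw [hF, Theory2.coupleFun_apply_of_pos _ _ he]
        simp only [he, ↓reduceDIte]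
        apply Subtype.ext
        change NormedSpace.exp (Q ⟨e, he⟩ (fun f => U f) (U e)) * (U e : Matrix (Fin n) (Fin n) ℂ) =
          NormedSpace.exp (Qamb ⟨e, he⟩ (coeConfig U)) * (U e : Matrix (Fin n) (Fin n) ℂ)
        rw [hQambQ ⟨e, he⟩]
      · rw [hF, Theory2.coupleFun_apply_of_neg _ _ he]
        simp only [he, ↓reduceDIte]
    rw [hF']
    refine continuous_pi fun e => ?_
    by_cases he : p e
    · simp only [he, ↓reduceDIte]
      exact ((continuous_matrix_exp.comp ((hQ2 ⟨e, he⟩).continuous.comp continuous_coeConfig)).mul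
        (continuous_subtype_val.comp (continuous_apply e))).subtype_mk _
    · simp only [he, ↓reduceDIte]
      exact continuous_apply e
  have hΦm : Measurable (FlowExistence.flowMap hZ1 1) :=
    ((FlowExistence.continuous_flowMap hZ1 hZt).comp (Continuous.prodMk_right (1 : ℝ))).measurable
  have hJq : (fun U : GaugeConfig d L (Matrix.specialUnitaryGroup (Fin n) ℂ) =>
      ENNReal.ofReal (∏ a : {e : Edge d L // p e}, (Top[(1 : ℝ), coeConfig U, a.1]).det)) =
      fun U => ENNReal.ofReal (q U) := funext fun U => by rw [hqJ U]
  rw [hJq]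
  refine ⟨hFcont.measurable, ENNReal.measurable_ofReal.comp hqc.measurable, ?_⟩
  have hμ : (Measure.pi fun _ : Edge d L => haarProbability (Matrix.specialUnitaryGroup (Fin n) ℂ)) =
      trivialMeasure (Matrix.specialUnitaryGroup (Fin n) ℂ) d L := rfl
  rw [hμ, ← hmap, Measure.map_map hFcont.measurable hΦm]
  have hcomp : F ∘ FlowExistence.flowMap hZ1 1 = id := funext hFΦ
  rw [hcomp, Measure.map_id]

end Main

end Summit.Ventures.LatticeQCDFlow.Exactness

end
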